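import Summits.QuantumFields.YangMills.Theorems.UnitScaleTiltProp8FlatProp4Bg1Lattice
import HarnessLib

/-!
# Route `UnitScaleTilt`, crux K1 child «MinimiserStabilityRegPr» (stmt-QuantumFields-19200), leaf V2′ `stub_halvingStep` — pillar P3b:
# **[Balaban1985Variational] PROPOSITION 4 (98) AT BACKGROUND 1 FOR THE PURE ACTION, AT THE d = 3 CARRIER** — the gradient `W₀ = (δ/δA′)V₀` of the
# non-quadratic part of the holomorphic `SU(2)` Wilson action in the exponential chart `U = e^{iηA}` at `U₀ = 1`, in print's normalisation
# (`A = Ση^{d−4}[1 − Re tr U(∂p)]`, pairing `η^d Σ_b tr`), EXISTS, IS HOLOMORPHIC, AND OBEYS `‖W₀(Y)(b)‖ ≤ C₄·r²` on the (115)-ball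
# `‖Y(b)‖ ≤ r`, `η⁻¹‖Y(b + e_ν) − Y(b)‖ ≤ r`, `r < ½`, with `C₄ = 6000·d` — member-uniform (no dependence on `η = L^{−(K−n)}` or the volume)

Cell `ym3-torus` (HUMAN RULING D-0037, YM ladder rung R3), width seat `ym-ust-19200-w5` gen 0 (OWNER ym3-torus-plan g24, W-SEAT MAP pass #2 2026-08-28:
«w5 = `stub_halvingStep` sub-lemma P3b = [Balaban1985Variational] Prop. 4 (98) pp. 292–293 at background 1 = the displayed `hWq`∕`hWd` of F4
`FlatSmallSolution158.existsUnique_smallSolution158_T3` … target `Theorems/UnitScaleTiltProp8FlatProp4Background1.lean`»).  `--supports stmt-QuantumFields-19200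
--as helper`; count-neutral.  YM₃ on T³ is a ladder rung (R3), not the Clay problem; nothing here is a claim about the crux, d = 4 or the mass gap.

THE PRINT ([Balaban1985Variational] = T. Bałaban, CMP **102** (1985) 277–309).  (5) p. 278: «A(U) = A^η(U) = Σ_{p⊂Ω₀} η^{d−4}[1 − Re tr U(∂p)], η = L^{−k}»;
(26)–(27) p. 282: «A(U₁U₀) = A(U₀) + ⟨A,J⟩ + ½⟨A,ΔA⟩ + V₀(A)», `⟨A,J⟩ = Σ_p η^{d−2} Im tr(…)` (so the pairing is `⟨X,Y⟩ = η^d Σ_b tr(X(b)Y(b))`); Prop. 4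
pp. 292–293: «The functional derivative of V(A′) is an analytic function on this space, and satisfies the estimate |(δ/δA′)V(A′)| ≤ C₄ε₃²(Lʲη)^{−3} on Ω_j (97).
The constants a₃, C₄ depend on d and L only. … |(δ/δA′)V(A′)|₍₋₃₎ ≤ C₄(max{|A′|₍₋₁₎, |∇A′|₍₋₂₎})² (98)»; Sect. F p. 302 uses this at background 1 («all the
operators in this section are taken without any external gauge field configuration»).

THE OBJECTS (tree normalisation; `η` a real parameter, at the carrier `η = L^{−(K−n)}`).  For a `𝔤ᶜ = M₂(ℂ)`-valued bond field `A` on `PBond P j` and a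
plaquette `p` with edges `b₁ = ⟨x,μ⟩, b₂ = ⟨x+e_μ,ν⟩, b₃ = ⟨x+e_ν,μ⟩, b₄ = ⟨x,ν⟩` (`GaugeField.plaqHol`'s convention) put `Y₁ = iηA(b₁)`, `Y₂ = iηA(b₂)`,
`Y₃ = −iηA(b₃)`, `Y₄ = −iηA(b₄)` and `𝔣_p(A) = 1 − ½tr(e^{Y₁}e^{Y₂}e^{Y₃}e^{Y₄}) + ½tr(ΣYᵢ) + ¼tr((ΣYᵢ)²)` (the plaquette term of `wilsonAction4` of
`e^{iηA}` on `SU(2)`, holomorphically continued, MINUS its linear and quadratic Taylor parts; the linear parts sum to zero over the torus,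
`FlatPlaqIncidence.sum_plaq_curl_eq_zero`).  `𝒱_η(A) := Σ_p 𝔣_p(A)` is print's `η^{4−d}·V₀`.  The gradient in print's pairing is
`W(A)(b) = η^{−d}·∂𝒱^{print}/∂A(b) = η^{−4}·(trace-dual of ∂𝒱_η/∂A(b))`; THIS is the `W` below (`= η^{−4}Σ_{ik} D𝒱_η(A)[1_b E_{ik}]·E_{ki}`).
WHAT IS PROVED (sorry-free; no definition — `W` is delivered by `∃` together with the identity that pins it uniquely; axioms standard):
* `norm_fderiv_single_le` — `|D𝒱_η(A)[1_b E]| ≤ 1450·d·η⁴r²` on the (115)-ball (`0 < r ≤ ½`, `‖E‖ ≤ 1`) — PART 4a's pairing and pair bounds summed.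
* **`exists_gradient_prop4_bg1`** — for every `Params`, level `j`, and `0 < η ≤ 1` there is `W : (PBond P j → M₂(ℂ)) → (PBond P j → M₂(ℂ))` with
  (grad) `𝒱_η` differentiable and `D𝒱_η(A)[δ] = η⁴·Σ_b tr(W(A)(b)·δ(b))` for all `A, δ`; (hWd) `W` differentiable (holomorphic) everywhere;
  (hWq) for `r < ½`, `‖Y(b)‖ ≤ r` and `η⁻¹‖Y(⟨s+e_ν,μ⟩) − Y(⟨s,μ⟩)‖ ≤ r` everywhere: `‖W(Y)(b)‖ ≤ 6000·d·r²` at every bond — EXACTLY the letter shapes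
  `hWq`∕`hWd` of `FlatSmallSolution158.existsUnique_smallSolution158` (weight `c = η⁻¹`, `a₃ = ½`, `C₄ = 6000d`).
* **`exists_gradient_prop4_bg1_T3`** — the same at the d = 3 carrier: `P = F.P K`, `η = L^{−(K−n)}`, weight `(F.L)^{K−n}`, `C₄ = 18000`, for EVERY
  member `F` of the T³ family and all heights `n, K` (member-uniform: the constants are absolute).
HONEST SCOPE.  (i) This is the PURE-ACTION part `V₀` of Prop. 4 at background 1 ((90)–(96)); the chart-dressing terms (84)–(89) (the operators `H`, `D(A′)`,
`δD/δA′`, `(QGQ*)⁻¹` of Sect. C — pillar P2's letters) are an abstract composition on top and are NOT here; (ii) the normalisation is print's (any other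
member-uniform choice rescales `C₄` by an absolute constant); (iii) constants crude; (iv) NOT a claim about the stub, the crux or the mass gap.

References: T. Bałaban, CMP **102** (1985) 277–309 [Balaban1985Variational] (5) p.278, (26)–(27) p.282, Prop. 4 (90)–(98) pp.291–293, Sect. F p.302.
-/

set_option autoImplicit false

noncomputable section

open scoped BigOperators Matrix.Norms.L2Operator
open NormedSpace Finset

namespace Summit.QuantumFields.YangMills.Theorems.FlatProp4Bg1

open Literature.MathematicalPhysics.QuantumFieldTheory.Balaban1983to89
open Summit.QuantumFields.YangMills.Theorems.FlatPlaqCubic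
open Summit.QuantumFields.YangMills.Theorems.FlatPlaqDeriv
open Summit.QuantumFields.YangMills.Theorems.FlatPlaqIncidence

variable {P : Params} {j : ℕ}

/-! ## §6 The directional derivative at one bond -/

section Bond

variable {η : ℝ} [DecidableEq (PBond P j)]

/-- **`|D𝒱_η(A)[1_b E]| ≤ 1450·d·η⁴r²`** on the (115)-ball of radius `r ∈ (0, ½]`, `‖E‖ ≤ 1`: the pairing of PART 4a summed over the `d` transverse
directions (each direction carries at most one (±) pair, bounded by `725η⁴r²`; the term `ν = μ` vanishes). [cite: Balaban1985Variational, (97)-(98) pp.292-293] -/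
theorem norm_fderiv_single_le (hη : 0 < η) (hη1 : η ≤ 1) {r : ℝ} (hr : 0 < r) (hr2 : r ≤ 1 / 2) (A : PBond P j → Matrix (Fin 2) (Fin 2) ℂ)
    (hA : ∀ b, ‖A b‖ ≤ r) (hD : ∀ (s : Site P j) (μ ν : Fin P.d), η⁻¹ * ‖A ⟨s.shift ν, μ⟩ - A ⟨s, μ⟩‖ ≤ r)
    (E : Matrix (Fin 2) (Fin 2) ℂ) (hE : ‖E‖ ≤ 1) (b : PBond P j) :
    ‖fderiv ℂ (fun A : PBond P j → Matrix (Fin 2) (Fin 2) ℂ => (∑ p : Plaq P j, (1 - (2 : ℂ)⁻¹ * Matrix.trace (exp ((Complex.I * (η : ℂ)) • A ⟨p.src, p.μ⟩) * exp ((Complex.I * (η : ℂ)) • A ⟨p.src.shift p.μ, p.ν⟩) * exp (-((Complex.I * (η : ℂ)) • A ⟨p.src.shift p.ν, p.μ⟩)) * exp (-((Complex.I * (η : ℂ)) • A ⟨p.src, p.ν⟩))) + (2 : ℂ)⁻¹ * Matrix.trace (((Complex.I * (η : ℂ)) • A ⟨p.src, p.μ⟩) + ((Complex.I * (η : ℂ))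 • A ⟨p.src.shift p.μ, p.ν⟩) + (-((Complex.I * (η : ℂ)) • A ⟨p.src.shift p.ν, p.μ⟩)) + (-((Complex.I * (η : ℂ)) • A ⟨p.src, p.ν⟩))) + (4 : ℂ)⁻¹ * Matrix.trace ((((Complex.I * (η : ℂ)) • A ⟨p.src, p.μ⟩) + ((Complex.I * (η : ℂ)) • A ⟨p.src.shift p.μ, p.ν⟩) + (-((Complex.I * (η : ℂ)) • A ⟨p.src.shift p.ν, p.μ⟩)) + (-((Complex.I * (η : ℂ)) • A ⟨p.src, p.ν⟩))) ^ 2)))) A (Pi.single b E)‖ ≤ 1450 * P.d * η ^ 4 * r ^ 2 := by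
  rw [fderiv_V_eq_sum, sum_deriv_line_single_eq_pairs]
  refine (norm_sum_le _ _).trans ?_
  have h0 : (0 : ℝ) ≤ 725 * η ^ 4 * r ^ 2 := by positivity
  refine (sum_le_sum (g := fun _ => 1450 * η ^ 4 * r ^ 2) fun ν _ => ?_).trans ?_
  · refine (norm_add_le _ _).trans ?_
    refine (add_le_add (?_ : _ ≤ 725 * η ^ 4 * r ^ 2) (?_ : _ ≤ 725 * η ^ 4 * r ^ 2)).trans (by linarith)
    · split_ifs with h
      · exact norm_pair13_le hη hη1 hr hr2 A hA hD E hE b ν h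
      · rwa [norm_zero]
    · split_ifs with h
      · exact norm_pair42_le hη hη1 hr hr2 A hA hD E hE b ν h
      · rwa [norm_zero]
  · rw [sum_const, card_univ, Fintype.card_fin, nsmul_eq_mul]
    exact le_of_eq (by ring)

end Bond

/-! ## §7 The gradient `W` and the main theorem -/

section Main

/-- The matrix units have operator norm `≤ 1` (tree: `MatrixNorms.opNorm_sq_le_sum_norm_sq`). [folklore] -/
theorem norm_single_le_one (i k : Fin 2) : ‖(Matrix.single k i (1 : ℂ) : Matrix (Fin 2) (Fin 2) ℂ)‖ ≤ 1 := by
  have h := MatrixNorms.opNorm_sq_le_sum_norm_sq (Matrix.single k i (1 : ℂ) : Matrix (Fin 2) (Fin 2) ℂ)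
  have hs : ∑ a : Fin 2, ∑ b : Fin 2, ‖(Matrix.single k i (1 : ℂ) : Matrix (Fin 2) (Fin 2) ℂ) a b‖ ^ 2 = 1 := by
    simp only [Matrix.single_apply]
    rw [Finset.sum_eq_single k, Finset.sum_eq_single i]
    · simp
    · intro b _ hb; simp [Ne.symm hb]
    · simp
    · intro a _ ha; simp [Ne.symm ha]
    · simp
  rw [hs] at h
  nlinarith [norm_nonneg (Matrix.single k i (1 : ℂ) : Matrix (Fin 2) (Fin 2) ℂ)]

/-- A bond field is the sum of its matrix-unit components: `δ = Σ_b Σ_{ik} δ(b)_{ik}·1_b E_{ik}`. [folklore] -/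
theorem field_eq_sum_single [DecidableEq (PBond P j)] (δ : PBond P j → Matrix (Fin 2) (Fin 2) ℂ) :
    δ = ∑ b : PBond P j, ∑ i : Fin 2, ∑ k : Fin 2, δ b i k • (Pi.single b (Matrix.single i k (1 : ℂ)) : PBond P j → Matrix (Fin 2) (Fin 2) ℂ) := by
  calc δ = ∑ b : PBond P j, (Pi.single b (δ b) : PBond P j → Matrix (Fin 2) (Fin 2) ℂ) := (Finset.univ_sum_single δ).symm
    _ = _ := by
      refine Finset.sum_congr rfl fun b _ => ?_
      funext b'
      by_cases hb : b' = b
      · subst hb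
        simp only [Pi.single_eq_same, Finset.sum_apply, Pi.smul_apply]
        conv_lhs => rw [Matrix.matrix_eq_sum_single (δ b')]
        refine Finset.sum_congr rfl fun i _ => Finset.sum_congr rfl fun k _ => ?_
        rw [Matrix.smul_single, smul_eq_mul, mul_one]
      · simp only [Pi.single_apply, if_neg hb, Finset.sum_apply, Pi.smul_apply, smul_zero, Finset.sum_const_zero]

/-- `tr(E_{ki}·X) = X_{ik}`. [folklore] -/
theorem trace_single_mul' (i k : Fin 2) (X : Matrix (Fin 2) (Fin 2) ℂ) : Matrix.trace ((Matrix.single k i (1 : ℂ) : Matrix (Fin 2) (Fin 2) ℂ) * X) = X i k := by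
  rw [Matrix.trace_single_mul, one_smul]

variable (η : ℝ)

/-- **[Balaban1985Variational] PROPOSITION 4 (98) AT BACKGROUND 1 FOR THE PURE ACTION — THE GRADIENT `W₀` EXISTS, IS HOLOMORPHIC AND IS `O(r²)` ON THE
(115)-BALL, MEMBER-UNIFORMLY.**  For every `Params`, level `j` and `0 < η ≤ 1` there is `W : (PBond P j → M₂(ℂ)) → (PBond P j → M₂(ℂ))` such that:
(i) `𝒱_η : A ↦ Σ_p [1 − ½tr(e^{iηA(b₁)}e^{iηA(b₂)}e^{−iηA(b₃)}e^{−iηA(b₄)}) + ½tr(ΣYᵢ) + ¼tr((ΣYᵢ)²)]` is differentiable and `D𝒱_η(A)[δ] = η⁴·Σ_b tr(W(A)(b)·δ(b))`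
for all `A, δ` (so `W` IS the gradient `(δ/δA′)V₀` in print's pairing `η^dΣ tr` of print's `V₀ = η^{d−4}𝒱_η`); (ii) `W` is differentiable everywhere
(«an analytic function on this space»); (iii) for `r < ½`, `‖Y(b)‖ ≤ r` and `η⁻¹‖Y(⟨s+e_ν,μ⟩) − Y(⟨s,μ⟩)‖ ≤ r` everywhere, `‖W(Y)(b)‖ ≤ 6000·d·r²` — the
letters `hWd`∕`hWq` of `FlatSmallSolution158.existsUnique_smallSolution158` with `a₃ = ½`, `C₄ = 6000d`, weight `c = η⁻¹`.
[cite: Balaban1985Variational, Prop. 4 (97)-(98) pp.292-293] -/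
theorem exists_gradient_prop4_bg1 (hη : 0 < η) (hη1 : η ≤ 1) :
    ∃ W : (PBond P j → Matrix (Fin 2) (Fin 2) ℂ) → (PBond P j → Matrix (Fin 2) (Fin 2) ℂ),
      Differentiable ℂ (fun A : PBond P j → Matrix (Fin 2) (Fin 2) ℂ => (∑ p : Plaq P j, (1 - (2 : ℂ)⁻¹ * Matrix.trace (exp ((Complex.I * (η : ℂ)) • A ⟨p.src, p.μ⟩) * exp ((Complex.I * (η : ℂ)) • A ⟨p.src.shift p.μ, p.ν⟩) * exp (-((Complex.I * (η : ℂ)) • A ⟨p.src.shift p.ν, p.μ⟩)) * exp (-((Complex.I * (η : ℂ)) • A ⟨p.src, p.ν⟩))) + (2 : ℂ)⁻¹ * Matrix.trace (((Complex.I * (η : ℂ)) • A ⟨p.src, p.μ⟩) + ((Complex.I * (η : ℂ)) • A ⟨p.src.shift p.μ, p.ν⟩) + (-((Complex.I * (η : ℂ)) • A ⟨p.src.shift p.ν, p.μ⟩)) + (-((Complex.I * (η : ℂ)) • A ⟨p.src, p.ν⟩))) + (4 : ℂ)⁻¹ * Matrix.trace ((((Complex.I * (η : ℂ)) • A ⟨p.src,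 p.μ⟩) + ((Complex.I * (η : ℂ)) • A ⟨p.src.shift p.μ, p.ν⟩) + (-((Complex.I * (η : ℂ)) • A ⟨p.src.shift p.ν, p.μ⟩)) + (-((Complex.I * (η : ℂ)) • A ⟨p.src, p.ν⟩))) ^ 2)))) ∧
      (∀ A δ : PBond P j → Matrix (Fin 2) (Fin 2) ℂ, fderiv ℂ (fun A : PBond P j → Matrix (Fin 2) (Fin 2) ℂ => (∑ p : Plaq P j, (1 - (2 : ℂ)⁻¹ * Matrix.trace (exp ((Complex.I * (η : ℂ)) • A ⟨p.src, p.μ⟩) * exp ((Complex.I * (η : ℂ)) • A ⟨p.src.shift p.μ, p.ν⟩) * exp (-((Complex.I * (η : ℂ)) • A ⟨p.src.shift p.ν, p.μ⟩)) * exp (-((Complex.I * (η : ℂ)) • A ⟨p.src, p.ν⟩))) + (2 : ℂ)⁻¹ * Matrix.trace (((Complex.I * (η : ℂ)) • A ⟨p.src, p.μ⟩) + ((Complex.I * (η : ℂ)) • A ⟨p.src.shift p.μ, p.ν⟩) + (-((Complex.I * (η : ℂ)) • A ⟨p.src.shift p.ν, p.μ⟩)) + (-((Complex.I * (η : ℂ))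 • A ⟨p.src, p.ν⟩))) + (4 : ℂ)⁻¹ * Matrix.trace ((((Complex.I * (η : ℂ)) • A ⟨p.src, p.μ⟩) + ((Complex.I * (η : ℂ)) • A ⟨p.src.shift p.μ, p.ν⟩) + (-((Complex.I * (η : ℂ)) • A ⟨p.src.shift p.ν, p.μ⟩)) + (-((Complex.I * (η : ℂ)) • A ⟨p.src, p.ν⟩))) ^ 2)))) A δ = (η : ℂ) ^ 4 * ∑ b : PBond P j, Matrix.trace (W A b * δ b)) ∧
      Differentiable ℂ W ∧
      (∀ (Y : PBond P j → Matrix (Fin 2) (Fin 2) ℂ) (r : ℝ), r < 1 / 2 → (∀ b, ‖Y b‖ ≤ r) →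
        (∀ (s : Site P j) (μ ν : Fin P.d), η⁻¹ * ‖Y ⟨s.shift ν, μ⟩ - Y ⟨s, μ⟩‖ ≤ r) → ∀ b, ‖W Y b‖ ≤ 6000 * P.d * r ^ 2) := by
  classical
  set V : (PBond P j → Matrix (Fin 2) (Fin 2) ℂ) → ℂ := (fun A : PBond P j → Matrix (Fin 2) (Fin 2) ℂ => (∑ p : Plaq P j, (1 - (2 : ℂ)⁻¹ * Matrix.trace (exp ((Complex.I * (η : ℂ)) • A ⟨p.src, p.μ⟩) * exp ((Complex.I * (η : ℂ)) • A ⟨p.src.shift p.μ, p.ν⟩) * exp (-((Complex.I * (η : ℂ)) • A ⟨p.src.shift p.ν, p.μ⟩)) * exp (-((Complex.I * (η : ℂ)) • A ⟨p.src, p.ν⟩))) + (2 : ℂ)⁻¹ * Matrix.trace (((Complex.I * (η : ℂ)) • A ⟨p.src, p.μ⟩) + ((Complex.I * (η : ℂ)) • A ⟨p.src.shift p.μ, p.ν⟩) + (-((Complex.I * (η : ℂ)) • A ⟨p.src.shift p.ν, p.μ⟩)) + (-((Complex.I * (η : ℂ)) • A ⟨p.src, p.ν⟩))) + (4 : ℂ)⁻¹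 * Matrix.trace ((((Complex.I * (η : ℂ)) • A ⟨p.src, p.μ⟩) + ((Complex.I * (η : ℂ)) • A ⟨p.src.shift p.μ, p.ν⟩) + (-((Complex.I * (η : ℂ)) • A ⟨p.src.shift p.ν, p.μ⟩)) + (-((Complex.I * (η : ℂ)) • A ⟨p.src, p.ν⟩))) ^ 2)))) with hVdef
  have hV2 : ContDiff ℂ 2 V := contDiff_V η
  have hVd : Differentiable ℂ V := differentiable_V η
  have hη4 : ((η : ℂ) ^ 4) ≠ 0 := pow_ne_zero _ (Complex.ofReal_ne_zero.mpr hη.ne')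
  -- the gradient
  let W : (PBond P j → Matrix (Fin 2) (Fin 2) ℂ) → (PBond P j → Matrix (Fin 2) (Fin 2) ℂ) := fun A b =>
    ((η : ℂ) ^ 4)⁻¹ • ∑ i : Fin 2, ∑ k : Fin 2, (fderiv ℂ V A (Pi.single b (Matrix.single i k (1 : ℂ)))) • (Matrix.single k i (1 : ℂ) : Matrix (Fin 2) (Fin 2) ℂ)
  refine ⟨W, hVd, fun A δ => ?_, ?_, fun Y r hr hA hD b => ?_⟩
  · -- (grad): linearity of `D𝒱_η(A)` on the matrix-unit decomposition of `δ`
    have hL : fderiv ℂ V A δ = ∑ b : PBond P j, ∑ i : Fin 2, ∑ k : Fin 2, δ b i k * fderiv ℂ V A (Pi.single b (Matrix.single i k (1 : ℂ))) := by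
      conv_lhs => rw [field_eq_sum_single δ]
      simp only [map_sum, map_smul, smul_eq_mul]
    rw [hL, Finset.mul_sum]
    refine Finset.sum_congr rfl fun b _ => ?_
    simp only [W, smul_mul_assoc, Matrix.trace_smul, Finset.sum_mul, Matrix.trace_sum, trace_single_mul', smul_eq_mul]
    rw [← mul_assoc, mul_inv_cancel₀ hη4, one_mul]
    exact Finset.sum_congr rfl fun i _ => Finset.sum_congr rfl fun k _ => mul_comm _ _
  · -- (hWd): `fderiv 𝒱_η` is `C¹`, hence differentiable; `W` is a linear image of it
    have hF : Differentiable ℂ (fderiv ℂ V) := (hV2.fderiv_right (m := 1) (by norm_num)).differentiable (by norm_num)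
    refine differentiable_pi.2 fun b => ?_
    show Differentiable ℂ (fun A : PBond P j → Matrix (Fin 2) (Fin 2) ℂ =>
      ((η : ℂ) ^ 4)⁻¹ • ∑ i : Fin 2, ∑ k : Fin 2, (fderiv ℂ V A (Pi.single b (Matrix.single i k (1 : ℂ)))) • (Matrix.single k i (1 : ℂ) : Matrix (Fin 2) (Fin 2) ℂ))
    have hS : Differentiable ℂ (fun A : PBond P j → Matrix (Fin 2) (Fin 2) ℂ =>
        ∑ i : Fin 2, ∑ k : Fin 2, (fderiv ℂ V A (Pi.single b (Matrix.single i k (1 : ℂ)))) • (Matrix.single k i (1 : ℂ) : Matrix (Fin 2) (Fin 2) ℂ)) :=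
      Differentiable.fun_sum fun i _ => Differentiable.fun_sum fun k _ => (hF.clm_apply (differentiable_const _)).smul_const _
    exact hS.const_smul (((η : ℂ) ^ 4)⁻¹)
  · -- (hWq): the directional bound of §6, `‖E_{ik}‖ ≤ 1`, four components; `r = 0` by approximation
    have key : ∀ r' : ℝ, 0 < r' → r' ≤ 1 / 2 → (∀ b, ‖Y b‖ ≤ r') →
        (∀ (s : Site P j) (μ ν : Fin P.d), η⁻¹ * ‖Y ⟨s.shift ν, μ⟩ - Y ⟨s, μ⟩‖ ≤ r') → ‖W Y b‖ ≤ 5800 * P.d * r' ^ 2 := by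
      intro r' hr' hr'2 hA' hD'
      have hik : ∀ i k : Fin 2, ‖(fderiv ℂ V Y (Pi.single b (Matrix.single i k (1 : ℂ)))) • (Matrix.single k i (1 : ℂ) : Matrix (Fin 2) (Fin 2) ℂ)‖
          ≤ 1450 * P.d * η ^ 4 * r' ^ 2 := by
        intro i k
        rw [norm_smul]
        have h1 := norm_fderiv_single_le hη hη1 hr' hr'2 Y hA' hD' (Matrix.single i k (1 : ℂ)) (norm_single_le_one k i) b
        have h2 := norm_single_le_one i k
        have h0 : 0 ≤ ‖fderiv ℂ V Y (Pi.single b (Matrix.single i k (1 : ℂ)))‖ := norm_nonneg _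
        calc _ ≤ ‖fderiv ℂ V Y (Pi.single b (Matrix.single i k (1 : ℂ)))‖ * 1 := mul_le_mul_of_nonneg_left h2 h0
          _ ≤ _ := by rw [mul_one]; exact h1
      have hsum : ‖∑ i : Fin 2, ∑ k : Fin 2, (fderiv ℂ V Y (Pi.single b (Matrix.single i k (1 : ℂ)))) • (Matrix.single k i (1 : ℂ) : Matrix (Fin 2) (Fin 2) ℂ)‖
          ≤ 4 * (1450 * P.d * η ^ 4 * r' ^ 2) := by
        refine (norm_sum_le _ _).trans ((sum_le_sum fun i _ => (norm_sum_le _ _).trans (sum_le_sum fun k _ => hik i k)).trans ?_)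
        simp only [sum_const, card_univ, Fintype.card_fin, nsmul_eq_mul, Nat.cast_ofNat]
        linarith
      have hn : ‖((η : ℂ) ^ 4)⁻¹‖ = (η ^ 4)⁻¹ := by
        rw [norm_inv, norm_pow, Complex.norm_real, Real.norm_eq_abs, abs_of_pos hη]
      show ‖((η : ℂ) ^ 4)⁻¹ • ∑ i : Fin 2, ∑ k : Fin 2, (fderiv ℂ V Y (Pi.single b (Matrix.single i k (1 : ℂ)))) • (Matrix.single k i (1 : ℂ) : Matrix (Fin 2) (Fin 2) ℂ)‖
        ≤ 5800 * P.d * r' ^ 2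
      rw [norm_smul, hn]
      have hη4pos : 0 < η ^ 4 := by positivity
      calc (η ^ 4)⁻¹ * ‖∑ i : Fin 2, ∑ k : Fin 2, (fderiv ℂ V Y (Pi.single b (Matrix.single i k (1 : ℂ)))) • (Matrix.single k i (1 : ℂ) : Matrix (Fin 2) (Fin 2) ℂ)‖
          ≤ (η ^ 4)⁻¹ * (4 * (1450 * P.d * η ^ 4 * r' ^ 2)) := mul_le_mul_of_nonneg_left hsum (by positivity)
        _ = 5800 * P.d * r' ^ 2 := by field_simp; ring
    have hd0 : (0 : ℝ) ≤ P.d := Nat.cast_nonneg _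
    have hr0 : 0 ≤ r := (norm_nonneg _).trans (hA ⟨default, ⟨0, P.hd⟩⟩)
    rcases hr0.eq_or_lt with h0 | hpos
    · -- `r = 0`: every `r′ ∈ (0, ½]` is admissible, so `‖W Y b‖ ≤ 5800·d·r′²` for all small `r′`, hence `‖W Y b‖ ≤ 0`
      subst h0
      have hsmall : ∀ r' : ℝ, 0 < r' → r' ≤ 1 / 2 → ‖W Y b‖ ≤ 5800 * P.d * r' ^ 2 := fun r' hr' hr'2 =>
        key r' hr' hr'2 (fun b' => (hA b').trans hr'.le) (fun s μ ν => (hD s μ ν).trans hr'.le)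
      have hle : ‖W Y b‖ ≤ 0 := by
        refine le_of_forall_pos_le_add fun ε hε => ?_
        set r' : ℝ := min (1 / 2) (ε / (5800 * P.d + 1)) with hr'
        have hK : (0 : ℝ) < 5800 * P.d + 1 := by positivity
        have hr'pos : 0 < r' := lt_min (by norm_num) (div_pos hε hK)
        have hr'2 : r' ≤ 1 / 2 := min_le_left _ _
        have hr'ε : r' ≤ ε / (5800 * P.d + 1) := min_le_right _ _
        have h1 := hsmall r' hr'pos hr'2
        have hrr : r' ^ 2 ≤ r' * (1 / 2) := by rw [sq]; exact mul_le_mul_of_nonneg_left hr'2 hr'pos.le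
        have h2 : 5800 * (P.d : ℝ) * r' ^ 2 ≤ 5800 * P.d * (r' * (1 / 2)) := mul_le_mul_of_nonneg_left hrr (by positivity)
        have h3 : 5800 * (P.d : ℝ) * (r' * (1 / 2)) ≤ (5800 * P.d + 1) * r' := by nlinarith
        have h4 : (5800 * (P.d : ℝ) + 1) * r' ≤ (5800 * P.d + 1) * (ε / (5800 * P.d + 1)) := mul_le_mul_of_nonneg_left hr'ε hK.le
        have h5 : (5800 * (P.d : ℝ) + 1) * (ε / (5800 * P.d + 1)) = ε := by field_simp
        linarith
      simpa using hle
    · by_cases hr2 : r ≤ 1 / 2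
      · exact (key r hpos hr2 hA hD).trans (by nlinarith [sq_nonneg r])
      · exact absurd hr (not_lt.mpr (le_of_lt (not_le.mp hr2)))

end Main

/-! ## §8 At the d = 3 carrier: `P = F.P K`, `η = L^{−(K−n)}`, weight `L^{K−n}`, `C₄ = 18000` -/

section T3

open T3ContinuumYM3Torus (T3Family)

/-- **PROPOSITION 4 (98) AT BACKGROUND 1 FOR THE PURE ACTION, AT THE d = 3 CARRIER OF `T3Thm1Carrier.varProblem3 F n K`** (fine torus `PBond (F.P K) 0`,
`η = L^{−(K−n)}`, the (115) weight `c = L^{K−n}` of `FlatSmallSolution158.existsUnique_smallSolution158_T3`): for EVERY member `F` of the T³ family and all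
heights `n, K` there is the gradient `W` of the non-quadratic pure action `𝒱_η` with (grad), (hWd) and (hWq) with `a₃ = ½`, `C₄ = 18000` — no constant depends
on the member, on `n` or on `K`. [cite: Balaban1985Variational, Prop. 4 (97)-(98) pp.292-293, Sect. F p.302] -/
theorem exists_gradient_prop4_bg1_T3 (F : T3Family) (n K : ℕ) :
    ∃ W : (PBond (F.P K) 0 → Matrix (Fin 2) (Fin 2) ℂ) → (PBond (F.P K) 0 → Matrix (Fin 2) (Fin 2) ℂ),
      Differentiable ℂ (fun A : PBond (F.P K) 0 → Matrix (Fin 2) (Fin 2) ℂ => ∑ p : Plaq (F.P K) 0, (1 - (2 : ℂ)⁻¹ * Matrix.trace (exp ((Complex.I * (((((F.L : ℝ)⁻¹) ^ (K - n) : ℝ)) : ℂ)) • A ⟨p.src, p.μ⟩) * exp ((Complex.I * (((((F.L : ℝ)⁻¹) ^ (K - n) : ℝ)) : ℂ)) • A ⟨p.src.shift p.μ, p.ν⟩) * exp (-((Complex.I * (((((F.L : ℝ)⁻¹) ^ (K - n) : ℝ)) : ℂ)) • A ⟨p.src.shift p.ν, p.μ⟩)) * exp (-((Complex.I * (((((F.L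 : ℝ)⁻¹) ^ (K - n) : ℝ)) : ℂ)) • A ⟨p.src, p.ν⟩))) + (2 : ℂ)⁻¹ * Matrix.trace (((Complex.I * (((((F.L : ℝ)⁻¹) ^ (K - n) : ℝ)) : ℂ)) • A ⟨p.src, p.μ⟩) + ((Complex.I * (((((F.L : ℝ)⁻¹) ^ (K - n) : ℝ)) : ℂ)) • A ⟨p.src.shift p.μ, p.ν⟩) + (-((Complex.I * (((((F.L : ℝ)⁻¹) ^ (K - n) : ℝ)) : ℂ)) • A ⟨p.src.shift p.ν, p.μ⟩)) + (-((Complex.I * (((((F.L : ℝ)⁻¹) ^ (K - n) : ℝ)) : ℂ)) • A ⟨p.src, p.ν⟩))) + (4 : ℂ)⁻¹ * Matrix.trace ((((Complex.I * (((((F.L : ℝ)⁻¹) ^ (K - n) : ℝ)) : ℂ)) • A ⟨p.src, p.μ⟩) + ((Complex.I * (((((F.L : ℝ)⁻¹) ^ (K - n) : ℝ)) : ℂ)) • A ⟨p.src.shift p.μ, p.ν⟩) + (-((Complex.I * (((((F.L : ℝ)⁻¹) ^ (K - n) : ℝ)) : ℂ)) • A ⟨p.src.shift p.ν, p.μ⟩))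 + (-((Complex.I * (((((F.L : ℝ)⁻¹) ^ (K - n) : ℝ)) : ℂ)) • A ⟨p.src, p.ν⟩))) ^ 2))) ∧
      (∀ A δ : PBond (F.P K) 0 → Matrix (Fin 2) (Fin 2) ℂ, fderiv ℂ (fun A : PBond (F.P K) 0 → Matrix (Fin 2) (Fin 2) ℂ => ∑ p : Plaq (F.P K) 0, (1 - (2 : ℂ)⁻¹ * Matrix.trace (exp ((Complex.I * (((((F.L : ℝ)⁻¹) ^ (K - n) : ℝ)) : ℂ)) • A ⟨p.src, p.μ⟩) * exp ((Complex.I * (((((F.L : ℝ)⁻¹) ^ (K - n) : ℝ)) : ℂ)) • A ⟨p.src.shift p.μ, p.ν⟩) * exp (-((Complex.I * (((((F.L : ℝ)⁻¹) ^ (K - n) : ℝ)) : ℂ)) • A ⟨p.src.shift p.ν, p.μ⟩)) * exp (-((Complex.I * (((((F.L : ℝ)⁻¹) ^ (K - n) : ℝ)) : ℂ)) • A ⟨p.src, p.ν⟩))) + (2 : ℂ)⁻¹ * Matrix.trace (((Complex.I * (((((F.L : ℝ)⁻¹) ^ (K - n) : ℝ)) : ℂ)) • A ⟨p.src, p.μ⟩)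 + ((Complex.I * (((((F.L : ℝ)⁻¹) ^ (K - n) : ℝ)) : ℂ)) • A ⟨p.src.shift p.μ, p.ν⟩) + (-((Complex.I * (((((F.L : ℝ)⁻¹) ^ (K - n) : ℝ)) : ℂ)) • A ⟨p.src.shift p.ν, p.μ⟩)) + (-((Complex.I * (((((F.L : ℝ)⁻¹) ^ (K - n) : ℝ)) : ℂ)) • A ⟨p.src, p.ν⟩))) + (4 : ℂ)⁻¹ * Matrix.trace ((((Complex.I * (((((F.L : ℝ)⁻¹) ^ (K - n) : ℝ)) : ℂ)) • A ⟨p.src, p.μ⟩) + ((Complex.I * (((((F.L : ℝ)⁻¹) ^ (K - n) : ℝ)) : ℂ)) • A ⟨p.src.shift p.μ, p.ν⟩) + (-((Complex.I * (((((F.L : ℝ)⁻¹) ^ (K - n) : ℝ)) : ℂ)) • A ⟨p.src.shift p.ν, p.μ⟩)) + (-((Complex.I * (((((F.L : ℝ)⁻¹) ^ (K - n) : ℝ)) : ℂ)) • A ⟨p.src, p.ν⟩))) ^ 2))) A δ =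
        ((((F.L : ℝ)⁻¹) ^ (K - n) : ℝ) : ℂ) ^ 4 * ∑ b : PBond (F.P K) 0, Matrix.trace (W A b * δ b)) ∧
      Differentiable ℂ W ∧
      (∀ (Y : PBond (F.P K) 0 → Matrix (Fin 2) (Fin 2) ℂ) (r : ℝ), r < 1 / 2 → (∀ b, ‖Y b‖ ≤ r) →
        (∀ (s : Site (F.P K) 0) (μ ν : Fin 3), (F.L : ℝ) ^ (K - n) * ‖Y ⟨s.shift ν, μ⟩ - Y ⟨s, μ⟩‖ ≤ r) → ∀ b, ‖W Y b‖ ≤ 18000 * r ^ 2) := by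
  have hL : (1 : ℝ) < F.L := by exact_mod_cast F.hL.2
  have hη : 0 < (((F.L : ℝ)⁻¹) ^ (K - n)) := pow_pos (inv_pos.mpr (by linarith)) _
  have hη1 : (((F.L : ℝ)⁻¹) ^ (K - n)) ≤ 1 := pow_le_one₀ (inv_nonneg.mpr (by linarith)) (inv_le_one_of_one_le₀ hL.le)
  obtain ⟨W, h1, h2, h3, h4⟩ := exists_gradient_prop4_bg1 (P := F.P K) (j := 0) (((F.L : ℝ)⁻¹) ^ (K - n)) hη hη1
  refine ⟨W, h1, h2, h3, fun Y r hr hA hD b => ?_⟩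
  have hinv : ((((F.L : ℝ)⁻¹) ^ (K - n)))⁻¹ = (F.L : ℝ) ^ (K - n) := by rw [inv_pow, inv_inv]
  have hD' : ∀ (s : Site (F.P K) 0) (μ ν : Fin (F.P K).d), ((((F.L : ℝ)⁻¹) ^ (K - n)))⁻¹ * ‖Y ⟨s.shift ν, μ⟩ - Y ⟨s, μ⟩‖ ≤ r := by
    intro s μ ν; rw [hinv]; exact hD s μ ν
  have h := h4 Y r hr hA hD' b
  have hd : ((F.P K).d : ℝ) = 3 := by simp
  rw [hd] at h
  linarith

end T3

end Summit.QuantumFields.YangMills.Theorems.FlatProp4Bg1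

end
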